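import Summits.MatrixMultiplication.MatrixMultiplication.Theses.ShapeSubmodularity
import Summits.MatrixMultiplication.MatrixMultiplication.Theses.EPRFaces
import Summits.MatrixMultiplication.MatrixMultiplication.Theorems.ShapeSubmodularityPerfectAmortisationStubCwRectRestriction
import Summits.MatrixMultiplication.MatrixMultiplication.Theorems.ShapeSubmodularityPerfectAmortisationStubCwRectDiagonalRaw
import Summits.MatrixMultiplication.MatrixMultiplication.Theorems.ShapeSubmodularityPerfectAmortisationStubCwRectEntropy
import Summits.MatrixMultiplication.MatrixMultiplication.Theorems.ShapeSubmodularityPerfectAmortisationStubCwRectThreshold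
import Summits.MatrixMultiplication.MatrixMultiplication.Theorems.ShapeSubmodularityPerfectAmortisationStubRateVanishes
import Literature.Computability.AlgebraicComplexity.RectangularExponentLaserCertificate
import Literature.Computability.AlgebraicComplexity.RectangularExponentAsymptoticRank
import Literature.Computability.AlgebraicComplexity.LaserMethodTypeCount
import Literature.Computability.AlgebraicComplexity.LaserMethodBigCW
import Literature.Computability.AlgebraicComplexity.SchonhageRectangular

/-!
# Crux `PerfectAmortisation` (E) — stmt-MatrixMultiplication-10893 — PROVED
(line `registered` = `Cruxes/PerfectAmortisation/Lines/birth.lean`)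

Routes `route-MatrixMultiplication-EPRFaces` (rank 2) and `route-MatrixMultiplication-ShapeSubmodularity`
(rank 3) share the crux verbatim; in rank form:

  `E : ∀ ε > 0, ∃ k ≥ 1, R(⟨n, n, n^k⟩) = O(n^{k+1+ε})`   (`inf_k [ω(1,1,k) − k − 1] = 0`),

a theorem of Coppersmith (1982, SIAM J. Comput. 11, p. 471) / Lotti–Romani (1983, TCS 23,
Prop. 4.1), proved here in modern dress: the FIRST-POWER laser method on the Coppersmith–Winograd
tensor `CW_q` (`R̃(CW_q) ≤ q + 2`, tree) with the far-rectangular joint type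
`Q = (m on (1,1,0), m on (0,1,1), k·m on (1,0,1))`, `N = (k+2)·m`, Schönhage's rectangular
asymptotic sum inequality, and finally `q = k + 2`, `k → ∞`.

The five registered stubs of the skeleton are the imported support files (all landed
`--supports stmt-MatrixMultiplication-10893`, namespace
`Summit.MatrixMultiplication.MatrixMultiplication.Theorems.PerfectAmortisation`):
* `stub_cwRectRestriction` (A, tensor layer) — a free diagonal `Δ` of level triples of joint type
  `(m₁, m₂, m₃)` on the three matrix patterns gives the RESTRICTION
  `CW_q^{⊗N} ≥ ⟨|Δ|⟩ ⊗ ⟨q^{m₁}, q^{m₂}, q^{m₃}⟩` (BCS Prop. 15.30);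
* `stub_cwRectDiagonalRaw` (B1, combinatorial layer) — `exists_free_diagonal_jointType_card` for
  `S = cwSupport₃`: a free `Δ ⊆ Φ_Q` with
  `2^{N (min_m H(P_m) − Γ_S(P))} ≤ |Δ| (N+1)^63 · 192 · exp(4 √(log 6 + N log 27))`;
* `stub_cwRectEntropy` (B2) — `log 2 · (min_m H(P_m) − Γ_S(P)) ≥ h(1/(k+2))`;
* `stub_cwRectThreshold` (C) — for `m` large the `o(N)` loss is `≤ δ m log q`:
  `(q+2)^N ≤ |Δ| · (q^m)^{f(k,q)+δ}`, `f(k,q) = (k+2)(log(q+2) − h(1/(k+2)))/log q`;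
* `stub_rateVanishes` (D) — `∀ ε ∃ q k, f(k,q) < k + 1 + ε`.
ASSEMBLY (this file): `cwRectDiagonal_of_stubs` (B1+B2), `cwLaserPacking_of_stubs` (the packing
certificate `CW_q^{⊗N} ⊵ ⟨V⟩ ⊗ ⟨a, a, a^k⟩`, `(q+2)^N ≤ V a^{f+δ}`), `omegaRect_le_of_packing`
(`ω(1,1,k) ≤ f(k,q)` via `mul_rpow_omegaRect_le_asymptoticRank`, `asymptoticRank_le_of_polyDegeneratesTo`,
`asymptoticRank_kroneckerPow_le`, `asymptoticRank_bigCwTensor_le`), `isBigO_of_omegaRect_lt`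
(dictionary `ω(1,1,k) < β` ⇒ rank-form O-bound), and the closing theorems `perfectAmortisation_proof` (EPRFaces decl, the item's registered conclusion) and
`perfectAmortisation_proof_shapeSubmodularity` (the sharing route's decl; same term).

Barriers: `RectangularBarrier` (CLLZ 2025 Thm. 3.15) caps what `CW_q` powers give at each FIXED
`k`; here `k → ∞` with `q = k+2`, where the cap on the excess itself tends to `0`.
`InfimumNotMinimumBarrier` respected (δ/ε-slack throughout).
-/

set_option linter.dupNamespace false
-- (single-conjunct summit: the namespace repeats `MatrixMultiplication`)

namespace Summit.MatrixMultiplication.MatrixMultiplication.Theorems.PerfectAmortisation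

open Literature.Computability.AlgebraicComplexity
open Literature.Barriers.MatrixMultiplication
open Filter Asymptotics

/-! ## Composition of the packing certificate (stubs A, B1, B2, C) -/

/-- Stubs B1 + B2: the free diagonal of the far-rectangular joint type with the size bound in
closed form, `exp(N h(1/(k+2))) ≤ |Δ| (N+1)^63 · 192 · exp(4 √(log 6 + N log 27))`. -/
theorem cwRectDiagonal_of_stubs (m k : ℕ) (hm : 1 ≤ m) (hk : 1 ≤ k) :
    ∃ Δ : Finset ((Fin ((k + 2) * m) → Fin 3) × (Fin ((k + 2) * m) → Fin 3) ×
        (Fin ((k + 2) * m) → Fin 3)),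
      (∀ δ ∈ Δ, ∀ ρ, labelSeq δ ρ ∈ cwSupport₃) ∧
      (∀ δ ∈ Δ, letterCount (labelSeq δ) (1, 1, 0) = m ∧ letterCount (labelSeq δ) (0, 1, 1) = m ∧
        letterCount (labelSeq δ) (1, 0, 1) = k * m) ∧
      (∀ δ ∈ Δ, ∀ δ' ∈ Δ, ∀ δ'' ∈ Δ, (∀ ρ, (δ.1 ρ, δ'.2.1 ρ, δ''.2.2 ρ) ∈ cwSupport₃) →
        δ = δ' ∧ δ' = δ'') ∧
      Real.exp ((((k + 2) * m : ℕ) : ℝ) * Real.binEntropy (1 / ((k : ℝ) + 2))) ≤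
        (Δ.card : ℝ) * ((((k + 2) * m : ℕ) : ℝ) + 1) ^ 63 * 192 *
          Real.exp (4 * Real.sqrt (Real.log 6 + (((k + 2) * m : ℕ) : ℝ) * Real.log 27)) := by
  set P : Fin 3 × Fin 3 × Fin 3 → ℝ := fun s =>
    ((if s = (1, 1, 0) then m else if s = (0, 1, 1) then m
        else if s = (1, 0, 1) then k * m else 0 : ℕ) : ℝ) / (((k + 2) * m : ℕ) : ℝ) with hP
  have hPs : ∀ s, P s = ((if s = (1, 1, 0) then m else if s = (0, 1, 1) then m
      else if s = (1, 0, 1) then k * m else 0 : ℕ) : ℝ) / (((k + 2) * m : ℕ) : ℝ) := fun s => rfl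
  obtain ⟨Δ, hS, hcnt, hfree, hsize⟩ := stub_cwRectDiagonalRaw m k hm hk P hPs
  have hent := stub_cwRectEntropy m k hm hk P hPs
  refine ⟨Δ, hS, hcnt, hfree, le_trans ?_ hsize⟩
  set X : ℝ := min (shannonEntropy (marginalDist₁ P))
      (min (shannonEntropy (marginalDist₂ P)) (shannonEntropy (marginalDist₃ P))) -
      maxEntropyPenalty cwSupport₃ P with hX
  have hN0 : (0 : ℝ) ≤ (((k + 2) * m : ℕ) : ℝ) := Nat.cast_nonneg _
  rw [Real.rpow_def_of_pos two_pos, Real.exp_le_exp]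
  calc (((k + 2) * m : ℕ) : ℝ) * Real.binEntropy (1 / ((k : ℝ) + 2))
      ≤ (((k + 2) * m : ℕ) : ℝ) * (Real.log 2 * X) := mul_le_mul_of_nonneg_left hent hN0
    _ = Real.log 2 * ((((k + 2) * m : ℕ) : ℝ) * X) := by ring

/-- **The planner's `stub_cwLaserPacking`, now derived** (stubs A, B1, B2, C): for
`q ≥ 2`, `k ≥ 1`, `δ > 0` there are `N, V ≥ 1`, `a ≥ 2`, `B ≥ a^k` with
`CW_q^{⊗N} ⊵ ⟨V⟩ ⊗ ⟨a, a, B⟩` and `(q+2)^N ≤ V · a^{f(k,q)+δ}` — witness `m` from stub C,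
`N = (k+2)m`, `Δ` from stubs B, `V = |Δ|`, `a = q^m`, `B = q^{km} = a^k`, the degeneration being
the restriction of stub A. -/
theorem cwLaserPacking_of_stubs :
    ∀ q k : ℕ, 2 ≤ q → 1 ≤ k → ∀ δ : ℝ, 0 < δ →
      ∃ N V a B : ℕ, 1 ≤ N ∧ 1 ≤ V ∧ 2 ≤ a ∧ a ^ k ≤ B ∧
        PolyDegeneratesTo (kroneckerPow (bigCwTensor ℂ q) N)
          (kroneckerTensor (unitTensor ℂ V) (matMulTensor ℂ a a B)) ∧
        ((q : ℝ) + 2) ^ N ≤ (V : ℝ) * (a : ℝ) ^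
          (((k : ℝ) + 2) * (Real.log ((q : ℝ) + 2) - Real.binEntropy (1 / ((k : ℝ) + 2))) /
              Real.log (q : ℝ) + δ) := by
  intro q k hq hk δ hδ
  obtain ⟨m, hm, hC⟩ := stub_cwRectThreshold q k hq hk δ hδ
  obtain ⟨Δ, hS, hcnt, hfree, hsize⟩ := cwRectDiagonal_of_stubs m k hm hk
  have hres := stub_cwRectRestriction q m m (k * m) ((k + 2) * m) Δ hS hcnt hfree
  refine ⟨(k + 2) * m, Δ.card, q ^ m, q ^ (k * m), ?_, ?_, ?_, ?_, hres.polyDegeneratesTo,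
    hC Δ.card hsize⟩
  · exact Nat.mul_pos (by omega) (by omega)
  · -- `|Δ| ≥ 1`: the left-hand side of the size bound is positive
    by_contra h0
    have h0' : Δ.card = 0 := by omega
    rw [h0', Nat.cast_zero, zero_mul, zero_mul, zero_mul] at hsize
    exact absurd hsize (not_le.2 (Real.exp_pos _))
  · exact le_trans hq (Nat.le_self_pow (by omega) q)
  · rw [← pow_mul, mul_comm]

/-! ## Assembly -/

/-- From the packing certificate at `(q, k)`: `ω(1,1,k) ≤ f(k,q)` — layers 1–2 of every laser-method
paper (`V a^{ω(1,1,k)} ≤ R̃(⟨V⟩ ⊗ ⟨a,a,B⟩) ≤ R̃(CW_q^{⊗N}) ≤ R̃(CW_q)^N ≤ (q+2)^N ≤ V a^{f+δ}`). -/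
theorem omegaRect_le_of_packing
    (hP : ∀ q k : ℕ, 2 ≤ q → 1 ≤ k → ∀ δ : ℝ, 0 < δ →
      ∃ N V a B : ℕ, 1 ≤ N ∧ 1 ≤ V ∧ 2 ≤ a ∧ a ^ k ≤ B ∧
        PolyDegeneratesTo (kroneckerPow (bigCwTensor ℂ q) N)
          (kroneckerTensor (unitTensor ℂ V) (matMulTensor ℂ a a B)) ∧
        ((q : ℝ) + 2) ^ N ≤ (V : ℝ) * (a : ℝ) ^
          (((k : ℝ) + 2) * (Real.log ((q : ℝ) + 2) - Real.binEntropy (1 / ((k : ℝ) + 2))) /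
              Real.log (q : ℝ) + δ))
    {q k : ℕ} (hq : 2 ≤ q) (hk : 1 ≤ k) :
    omegaRect ℂ 1 1 (k : ℝ) ≤
      ((k : ℝ) + 2) * (Real.log ((q : ℝ) + 2) - Real.binEntropy (1 / ((k : ℝ) + 2))) /
        Real.log (q : ℝ) := by
  set f : ℝ := ((k : ℝ) + 2) * (Real.log ((q : ℝ) + 2) - Real.binEntropy (1 / ((k : ℝ) + 2))) /
        Real.log (q : ℝ) with hf
  refine le_of_forall_pos_lt_add fun δ hδ => ?_
  obtain ⟨N, V, a, B, hN, hV, ha, haB, hdeg, hnum⟩ := hP q k hq hk (δ / 2) (half_pos hδ)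
  have ha1 : (1 : ℝ) < a := by exact_mod_cast (by omega : 1 < a)
  have hV0 : (0 : ℝ) < V := by exact_mod_cast (by omega : 0 < V)
  have hk0 : (0 : ℝ) ≤ (k : ℝ) := Nat.cast_nonneg k
  have haB' : (a : ℝ) ^ (k : ℝ) ≤ (B : ℝ) := by
    rw [Real.rpow_natCast]
    exact_mod_cast haB
  have h1 := mul_rpow_omegaRect_le_asymptoticRank ℂ hk0 hV ha haB'
  have h2 := asymptoticRank_le_of_polyDegeneratesTo hdeg
  have hcw : asymptoticRank (bigCwTensor ℂ q) ≤ (q : ℝ) + 2 := by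
    exact_mod_cast asymptoticRank_bigCwTensor_le ℂ q
  have h3 : asymptoticRank (kroneckerPow (bigCwTensor ℂ q) N) ≤ ((q : ℝ) + 2) ^ N :=
    (asymptoticRank_kroneckerPow_le _ hN).trans
      (pow_le_pow_left₀ (asymptoticRank_nonneg _) hcw N)
  have hchain : (V : ℝ) * (a : ℝ) ^ omegaRect ℂ 1 1 (k : ℝ) ≤ (V : ℝ) * (a : ℝ) ^ (f + δ / 2) :=
    h1.trans (h2.trans (h3.trans hnum))
  have h4 : (a : ℝ) ^ omegaRect ℂ 1 1 (k : ℝ) ≤ (a : ℝ) ^ (f + δ / 2) :=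
    le_of_mul_le_mul_left hchain hV0
  have h5 : omegaRect ℂ 1 1 (k : ℝ) ≤ f + δ / 2 := (Real.rpow_le_rpow_left_iff ha1).1 h4
  linarith

/-- Dictionary: a strict upper bound `ω(1,1,k) < β` at a natural exponent `k` is the rank-form
O-bound `R(⟨n, n, n^k⟩) = O(n^β)` (`⌈n^1⌉ = n`, `⌈n^k⌉ = n^k`, upward closure of admissible sets). -/
theorem isBigO_of_omegaRect_lt {k : ℕ} {β : ℝ} (h : omegaRect ℂ 1 1 (k : ℝ) < β) :
    (fun n : ℕ => (tensorRank (matMulTensor ℂ n n (n ^ k)) : ℝ)) =O[atTop]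
      fun n : ℕ => (n : ℝ) ^ β := by
  have hne := rectAdmissibleExponents_nonempty ℂ 1 1 (k : ℝ)
  unfold omegaRect at h
  obtain ⟨β', hβ', hlt⟩ := exists_lt_of_csInf_lt hne h
  have hβ : β ∈ rectAdmissibleExponents ℂ 1 1 (k : ℝ) :=
    mem_rectAdmissibleExponents_of_le hβ' hlt.le
  have hfun : (fun n : ℕ => (tensorRank (matMulTensor ℂ n n (n ^ k)) : ℝ)) =
      fun n : ℕ =>
        (tensorRank (matMulTensor ℂ (rectDim n 1) (rectDim n 1) (rectDim n (k : ℝ))) : ℝ) := by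
    funext n
    rw [tensorRank_matMulTensor_congr ℂ (rectDim_one n).symm (rectDim_one n).symm
      (rectDim_natCast n k).symm]
  rw [hfun]
  exact hβ

/-- **Crux E `PerfectAmortisation`, proved** — the item's primary decl
`EPRFaces.PerfectAmortisation` (route EPRFaces, rank 2) BY NAME: for every `ε > 0` there is
`k ≥ 1` with `R(⟨n, n, n^k⟩) = O(n^{k+1+ε})` (Coppersmith 1982 / Lotti–Romani 1983 Prop. 4.1,
by the first-power `CW_q` laser method in the far-rectangular weighting and `q = k+2 → ∞`):
the rate stub picks `(q, k)` with `f(k,q) < k + 1 + ε`, the packing certificate gives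
`ω(1,1,k) ≤ f(k,q)`, and the dictionary turns `ω(1,1,k) < k + 1 + ε` into the O-bound. -/
theorem perfectAmortisation_proof :
    Summit.MatrixMultiplication.MatrixMultiplication.Theses.EPRFaces.PerfectAmortisation := by
  intro ε hε
  obtain ⟨q, k, hq, hk, hlt⟩ := stub_rateVanishes ε hε
  exact ⟨k, hk, isBigO_of_omegaRect_lt
    ((omegaRect_le_of_packing cwLaserPacking_of_stubs hq hk).trans_lt hlt)⟩

/-- The same conclusion under the sharing route's name `ShapeSubmodularity.PerfectAmortisation`
(route-MatrixMultiplication-ShapeSubmodularity, rank 3; the two decls are the same term). -/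
theorem perfectAmortisation_proof_shapeSubmodularity :
    Summit.MatrixMultiplication.MatrixMultiplication.Theses.ShapeSubmodularity.PerfectAmortisation := by
  intro ε hε
  obtain ⟨q, k, hq, hk, hlt⟩ := stub_rateVanishes ε hε
  exact ⟨k, hk, isBigO_of_omegaRect_lt
    ((omegaRect_le_of_packing cwLaserPacking_of_stubs hq hk).trans_lt hlt)⟩

end Summit.MatrixMultiplication.MatrixMultiplication.Theorems.PerfectAmortisation
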